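import Literature.Barriers.ValiantsHypothesis.GCTMatrixPoweringProofs
import Literature.NumberTheory.DiophantineGeometry.PowerTraceOrbitBound
import Literature.Computability.Complexity.OccurrenceObstructionsProofs
import Literature.Computability.AlgebraicComplexity.OrbitClosureProofs
import Mathlib.Algebra.BigOperators.Fin
import HarnessLib

/-!
# Barrier catalogue `ValiantsHypothesis`, GCT and matrix powering — discharge of `GIP2017_cor9`
# (Gesmundo–Ikenmeyer–Panova 2017, Cor. 9: the orbit-occurrence-obstruction principle)

Second proofs file of `Literature/Barriers/ValiantsHypothesis/GCTMatrixPowering.lean`, next to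
`GCTMatrixPoweringProofs.lean` (Thm. 10: Lemma 12, Prop. 13 proved, Props. 14/20 named), whose
degree-zero lemma `smPos_of_eq_zero` is reused here. The barrier file vendors as a named fact
`Literature.Barriers.ValiantsHypothesis.GIP2017_cor9`: "If `λ ⊢ dm` and
`sm(λ, n) = 0 < q_λ(d[m])`, then `pc(per_m) > n`" (arXiv:1611.00827, Cor. 9, from Prop. 5,
Cor. 6 and Thm. 8; tree letters: permanent size `n ≥ 3`, matrix size `m ≥ 3`,
`IsOrbitOccurrenceObstruction n m λ → m < powTraceComplexity ℂ per_n n`). This file PROVES it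
(`GIP2017_cor9_holds`), following the printed architecture:

1. `pc(per_n)` is well defined (`exists_hasPowTraceRepr_perPoly`): `per_n = tr(B^n)` for the
   block-diagonal matrix `B` (one block per permutation `σ`) of weighted `n`-cycles with weights
   `X_{σ i, i}` (`cycMat`, `trace_cycMat_pow`: `tr(C^n) = n ∏ w`), the first weight divided by
   `n`; and a representation of size `m₁ ≤ m` pads to size `m` (`HasPowTraceRepr.of_le`).
2. Prop. 5 ("If `\overline{GL_{n²} per_m} ⊄ \overline{GL_{n²} Pow^m_n}`, then `pc(per_m) > n`",
   "completely analogously to Prop. 2"): if `per_n = tr(A^n)` for an `m × m` matrix `A` of linear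
   forms then the unpadded block permanent `blockPerFormLex n m` is the linear substitution of
   `Pow = powFormLex ℂ m n` by the (possibly singular) coefficient matrix of the entries of `A`
   (`exists_linSubst_powFormLex_eq`), hence lies in the orbit closure of `Pow`
   (`blockPerFormLex_mem_orbitClosure_powFormLex`, by the tree's
   `endOrbit_subset_orbitClosure_holds`: `GL` is Zariski dense in `End`).
3. Cor. 6 ("As in the padded setting Schur's lemma implies"): occurrence lifts along the
   equivariant surjection `ℂ[Δ(Pow)] ↠ ℂ[Δ(per)]` (tree:
   `Literature.Computability.Complexity.hasHighestWeight_orbitCoordRep_of_mem_orbitClosure`,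
   complete reducibility).
4. Thm. 8 / Thm. 24 inequality `t_λ ≤ sm(λ) = Σ_μ sk(λ, μ)`: PROVED in
   `Literature.NumberTheory.DiophantineGeometry.PowerTraceOrbitBound`
   (`exists_sum_ne_zero_of_hasHighestWeight_powFormLex`), giving `SmPos m λ` and contradicting
   the obstruction.
5. The junk regime `m < n` of the Lean statement (the block is then all of `Fin m`,
   `blockPerFormLex n m` has degree `< n`): only the weight `0` can occur in the degree-`n`
   coordinate ring (`weight_eq_zero_of_hasHighestWeight_of_isHomogeneous`), forcing `d·n = 0`
   (`eq_zero_of_partitionWeightLex_eq_zero`), i.e. `d = 0`, where `sm > 0` trivially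
   (`smPos_of_eq_zero` of `GCTMatrixPoweringProofs.lean`: `skCharSum ∅ ∅ = 2`).

## References

* F. Gesmundo, C. Ikenmeyer, G. Panova, *Geometric complexity theory and matrix powering*,
  Diff. Geom. Appl. 55 (2017) 106–127 = arXiv:1611.00827 (held, `lit read`, pp. 5–7, 13–14):
  §2.2 (definition of `pc`, Prop. 5, Cor. 6, Thm. 7, Thm. 8, Cor. 9), §4 (Thm. 24).
  [GesmundoIkenmeyerPanova2017]

## Design

`namespace Literature.Barriers.ValiantsHypothesis`; everything over `ℂ` as in the barrier file.
The statement `GIP2017_cor9` is untouched; users holding `(h9 : GIP2017_cor9)` (e.g.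
`GCTMatrixPowering.certified_bound_le`) feed `GIP2017_cor9_holds`. The named facts
`GIP2017_thm10` (the barrier itself) and `GIP2017_pc_le` (Grenet's `2^n - 1`) are NOT discharged
here; `exists_hasPowTraceRepr_perPoly` gives the weaker witness `pc(per_n) ≤ n · n!` only as an
existence statement.
-/

noncomputable section

open scoped BigOperators Matrix
open MvPolynomial

namespace Literature.Barriers.ValiantsHypothesis

open Literature.NumberTheory.DiophantineGeometry Literature.Computability.AlgebraicComplexity

/-! ### `per_n` is the trace of a matrix power: block-diagonal weighted cycles -/

section CyclePower

variable {R : Type*} [CommRing R] {n : ℕ} [NeZero n]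

/-- The weighted cyclic shift: `C_{i, i+1} = w i`, all other entries `0` (indices in `Fin n`,
cyclically). Its `n`-th power is the scalar-like diagonal `∏ w` (`cycMat_pow_apply`). The
standard "a monomial is the trace of a power of a weighted cycle" gadget behind `per ∈ VNP`-type
normal forms; here it only witnesses that `pc(per_n)` is finite. [folklore] -/
def cycMat (w : Fin n → R) : Matrix (Fin n) (Fin n) R :=
  Matrix.of fun i j => if j = i + 1 then w i else 0

/-- Powers of the weighted cycle: `(C^l)_{i j} = [j = i + l] ∏_{t < l} w (i + t)`. [folklore] -/
theorem cycMat_pow_apply (w : Fin n → R) (l : ℕ) (i j : Fin n) :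
    (cycMat w ^ l) i j =
      if j = i + l • (1 : Fin n) then ∏ t ∈ Finset.range l, w (i + t • (1 : Fin n)) else 0 := by
  induction l generalizing i j with
  | zero =>
    rw [pow_zero, Matrix.one_apply, zero_nsmul, add_zero, Finset.range_zero, Finset.prod_empty]
    simp only [eq_comm]
  | succ l ih =>
    rw [pow_succ, Matrix.mul_apply, Finset.sum_eq_single (i + l • (1 : Fin n))]
    · rw [ih, if_pos rfl, cycMat, Matrix.of_apply]
      by_cases hj : j = i + (l + 1) • (1 : Fin n)
      · rw [if_pos hj, if_pos (by rw [hj, succ_nsmul, add_assoc]), Finset.prod_range_succ]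
      · rw [if_neg hj, if_neg, mul_zero]
        intro hj'
        apply hj
        rw [hj', succ_nsmul, add_assoc]
    · intro t _ ht
      rw [ih, if_neg ht, zero_mul]
    · intro h
      exact absurd (Finset.mem_univ _) h

open Fin.NatCast in
/-- `l • 1 = l` in `Fin n` (with the scoped `ℕ → Fin n` cast). [folklore] -/
theorem nsmul_one_eq_natCast (l : ℕ) : l • (1 : Fin n) = (l : Fin n) :=
  nsmul_one l

open Fin.NatCast in
/-- Along the cycle every index is met once: `∏_{t < n} f (i + t) = ∏_j f j`. [folklore] -/
theorem prod_range_add_nsmul (f : Fin n → R) (i : Fin n) :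
    ∏ t ∈ Finset.range n, f (i + t • (1 : Fin n)) = ∏ j, f j := by
  simp only [nsmul_one_eq_natCast]
  rw [← Fin.prod_univ_eq_prod_range (fun t => f (i + (t : Fin n))) n]
  simp only [Fin.cast_val_eq_self]
  exact Fintype.prod_equiv (Equiv.addLeft i) _ _ fun _ => rfl

open Fin.NatCast in
/-- `n • 1 = 0` in `Fin n`. [folklore] -/
theorem self_nsmul_one : n • (1 : Fin n) = 0 := by
  rw [nsmul_one_eq_natCast, Fin.natCast_self]

/-- **`tr(C^n) = n · ∏_j w j`** for the weighted `n`-cycle. [folklore] -/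
theorem trace_cycMat_pow (w : Fin n → R) : (cycMat w ^ n).trace = n • ∏ j, w j := by
  unfold Matrix.trace
  simp only [Matrix.diag_apply, cycMat_pow_apply, self_nsmul_one, add_zero, if_true,
    prod_range_add_nsmul, Finset.sum_const, Finset.card_univ, Fintype.card_fin]

variable (n)

/-- The weights of the cycle of a permutation `σ`: `X_{σ i, i}`, the weight at `i = 0` divided by
`n` (so that the `n` diagonal entries of the `n`-th power add up to the monomial of `σ`).
[folklore] -/
def cycWeights (σ : Equiv.Perm (Fin n)) (i : Fin n) : MvPolynomial (Fin n × Fin n) ℂ :=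
  C (if i = 0 then ((n : ℂ)⁻¹) else 1) * X (σ i, i)

/-- The block-diagonal matrix of the weighted cycles of all permutations (size `n · n!`), a matrix
of homogeneous linear forms with `tr(B^n) = per_n`. [folklore] -/
def perCycMat : Matrix (Fin n × Equiv.Perm (Fin n)) (Fin n × Equiv.Perm (Fin n))
    (MvPolynomial (Fin n × Fin n) ℂ) :=
  Matrix.blockDiagonal fun σ => cycMat (cycWeights n σ)

/-- `n · ∏_j w_σ j = ∏_j X_{σ j, j}`, the monomial of `σ` in the permanent. [folklore] -/
theorem prod_cycWeights (σ : Equiv.Perm (Fin n)) :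
    n • ∏ j, cycWeights n σ j = ∏ j, X (σ j, j) := by
  unfold cycWeights
  rw [Finset.prod_mul_distrib, ← map_prod, Finset.prod_ite_eq', if_pos (Finset.mem_univ _),
    nsmul_eq_mul, ← mul_assoc, ← map_natCast C, ← map_mul,
    mul_inv_cancel₀ (Nat.cast_ne_zero.mpr (NeZero.ne n)), map_one, one_mul]

/-- **`per_n = tr(B^n)`** for the block-diagonal matrix of weighted cycles
(`per (X_{ij}) = ∑_σ ∏_i X_{σ i, i}`, Mathlib's `Matrix.permanent`). [folklore] -/
theorem trace_perCycMat_pow : (perCycMat n ^ n).trace = perPoly (Fin n) ℂ := by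
  rw [perCycMat, ← Matrix.blockDiagonal_pow, Matrix.trace_blockDiagonal]
  simp only [Pi.pow_apply, trace_cycMat_pow, prod_cycWeights]
  rw [perPoly, Matrix.permanent]
  rfl

/-- The entries of `B` are homogeneous linear forms (`C c * X v` or `0`). [folklore] -/
theorem isHomogeneous_perCycMat (p q : Fin n × Equiv.Perm (Fin n)) :
    (perCycMat n p q).IsHomogeneous 1 := by
  obtain ⟨i, σ⟩ := p
  obtain ⟨j, τ⟩ := q
  rw [perCycMat, Matrix.blockDiagonal_apply]
  split_ifs
  · rw [cycMat, Matrix.of_apply]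
    split_ifs
    · exact (isHomogeneous_C _ _).mul (isHomogeneous_X _ _)
    · exact isHomogeneous_zero _ _ _
  · exact isHomogeneous_zero _ _ _

/-- The trace is invariant under reindexing of the matrix. [folklore] -/
theorem trace_reindex {ι κ S : Type*} [Fintype ι] [Fintype κ] [AddCommMonoid S] (e : ι ≃ κ)
    (M : Matrix ι ι S) : (Matrix.reindex e e M).trace = M.trace := by
  unfold Matrix.trace
  exact Fintype.sum_equiv e.symm _ _ fun _ => rfl

/-- **`pc(per_n)` is well defined** (`n ≥ 1`): `per_n = tr(B^n)` for a square matrix `B` of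
homogeneous linear forms, of size `n · n!` (the set over which `powTraceComplexity` takes its
infimum is nonempty). GIP §2.2: "Let `pc(per_m)` denote the smallest `n` such that `per_m` can
be written as `p = tr(A^m)`". [cite: GesmundoIkenmeyerPanova2017, §2.2 (definition of pc)] -/
theorem exists_hasPowTraceRepr_perPoly :
    ∃ N₀ : ℕ, HasPowTraceRepr ℂ (perPoly (Fin n) ℂ) n N₀ := by
  classical
  set e := Fintype.equivFin (Fin n × Equiv.Perm (Fin n)) with he
  refine ⟨Fintype.card (Fin n × Equiv.Perm (Fin n)), Matrix.reindex e e (perCycMat n),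
    fun a b => isHomogeneous_perCycMat n _ _, ?_⟩
  have hpow : (Matrix.reindex e e (perCycMat n)) ^ n = Matrix.reindex e e (perCycMat n ^ n) := by
    change (Matrix.reindexAlgEquiv ℂ _ e (perCycMat n)) ^ n =
      Matrix.reindexAlgEquiv ℂ _ e (perCycMat n ^ n)
    rw [map_pow]
  rw [hpow, trace_reindex, trace_perCycMat_pow]

end CyclePower

/-! ### Prop. 5: a power-trace representation of size `≤ m` puts `per_n` into `Δ(Pow^n_m)` -/

section PropFive

variable {n m : ℕ}

/-- The embedding of the `n²` variables of `per_n` into the lexicographic `m × m` matrix variables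
as the top-left block (`n ≤ m`). [cite: GesmundoIkenmeyerPanova2017, §2.2 (the homogeneous setting)] -/
def blockEmb (hnm : n ≤ m) : Fin n × Fin n → MatIdx m :=
  fun ij => toLex (Fin.castLE hnm ij.1, Fin.castLE hnm ij.2)

/-- The unpadded block permanent `blockPerFormLex n m` is the generic permanent `per_n` renamed
along `blockEmb` (`rename_perPoly_equiv` for `Fin n ≃ TopBlockIdx n m`).
[cite: GesmundoIkenmeyerPanova2017, §2.2 (the homogeneous setting)] -/
theorem blockPerFormLex_eq_rename (hnm : n ≤ m) :
    Literature.Barriers.PneNP.blockPerFormLex n m = rename (blockEmb hnm) (perPoly (Fin n) ℂ) := by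
  let e : Fin n ≃ Literature.Computability.Complexity.TopBlockIdx n m :=
    { toFun := fun i => ⟨Fin.castLE hnm i, by simp⟩
      invFun := fun j => ⟨(j.1 : ℕ), j.2⟩
      left_inv := fun i => by ext; rfl
      right_inv := fun j => by ext; rfl }
  rw [Literature.Barriers.PneNP.blockPerFormLex, Literature.Barriers.PneNP.blockPerPoly,
    ← rename_perPoly_equiv e, rename_rename, rename_rename]
  rfl

/-- A homogeneous linear form is the sum of its coefficients times the variables:
`p = ∑_v coeff_{e_v}(p) • X_v` (a monomial of degree one is a variable). [folklore] -/
theorem eq_sum_coeff_smul_X {τ : Type*} [Fintype τ] [DecidableEq τ] {R : Type*} [CommSemiring R]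
    {p : MvPolynomial τ R} (hp : p.IsHomogeneous 1) :
    p = ∑ v : τ, coeff (Finsupp.single v 1) p • X v := by
  classical
  ext d
  rw [coeff_sum]
  simp only [coeff_smul, coeff_X, smul_eq_mul, mul_ite, mul_one, mul_zero]
  by_cases hd : ∃ v, Finsupp.single v 1 = d
  · obtain ⟨v, rfl⟩ := hd
    rw [Finset.sum_eq_single v]
    · rw [if_pos rfl]
    · intro u _ huv
      rw [if_neg]
      intro h
      exact huv ((Finsupp.single_left_inj one_ne_zero).mp h)
    · intro h
      exact absurd (Finset.mem_univ v) h
  · rw [Finset.sum_eq_zero fun v _ => if_neg fun h => hd ⟨v, h⟩]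
    by_contra hne
    have hdeg : d.degree = 1 := by
      rw [Finsupp.degree_eq_weight_one]
      exact hp hne
    apply hd
    have hd0 : d ≠ 0 := by
      rintro rfl
      simp at hdeg
    obtain ⟨v, hv⟩ := Finsupp.support_nonempty_iff.mpr hd0
    have hv1 : d v = 1 := by
      have := Finsupp.le_degree v d
      rw [hdeg] at this
      have hpos : 0 < d v := Nat.pos_of_ne_zero (Finsupp.mem_support_iff.mp hv)
      omega
    refine ⟨v, ?_⟩
    have hle : Finsupp.single v 1 ≤ d := Finsupp.single_le_iff.mpr (by rw [hv1])
    obtain ⟨d', rfl⟩ := exists_add_of_le hle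
    have : d'.degree = 0 := by
      have h2 := hdeg
      rw [map_add, Finsupp.degree_single] at h2
      omega
    rw [Finsupp.degree_eq_zero_iff] at this
    rw [this, add_zero]

/-- The trace of a `2 × 2` block matrix is the sum of the traces of the diagonal blocks.
[folklore] -/
theorem trace_fromBlocks' {ι κ S : Type*} [Fintype ι] [Fintype κ] [AddCommMonoid S]
    (A : Matrix ι ι S) (B : Matrix ι κ S) (C' : Matrix κ ι S) (D : Matrix κ κ S) :
    (Matrix.fromBlocks A B C' D).trace = A.trace + D.trace := by
  unfold Matrix.trace
  rw [Fintype.sum_sum_type]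
  simp only [Matrix.diag_apply, Matrix.fromBlocks_apply₁₁, Matrix.fromBlocks_apply₂₂]

/-- **Padding**: a power-trace representation `f = tr(A^n)` of size `m₁ ≤ m` (`n ≥ 1`) gives one
of size `m` (block `A ⊕ 0`; `tr((A ⊕ 0)^n) = tr(A^n) + tr(0^n)`). In particular the least size
`powTraceComplexity` is attained by representations of every larger size.
[cite: GesmundoIkenmeyerPanova2017, §2.2 (definition of pc)] -/
theorem HasPowTraceRepr.of_le {σ : Type*} {k : Type*} [Field k] {f : MvPolynomial σ k}
    {n m₁ m : ℕ} (hn : 0 < n) (hm₁ : m₁ ≤ m) (h : HasPowTraceRepr k f n m₁) :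
    HasPowTraceRepr k f n m := by
  classical
  obtain ⟨A, hA1, hAtr⟩ := h
  set e : Fin m₁ ⊕ Fin (m - m₁) ≃ Fin m := finSumFinEquiv.trans (finCongr (Nat.add_sub_cancel' hm₁))
    with he
  set A' : Matrix (Fin m) (Fin m) (MvPolynomial σ k) :=
    Matrix.reindex e e (Matrix.fromBlocks A 0 0 (0 : Matrix (Fin (m - m₁)) (Fin (m - m₁)) _))
    with hA'
  refine ⟨A', fun i j => ?_, ?_⟩
  · rw [hA', Matrix.reindex_apply, Matrix.submatrix_apply]
    rcases e.symm i with i' | i' <;> rcases e.symm j with j' | j'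
    · rw [Matrix.fromBlocks_apply₁₁]; exact hA1 _ _
    · rw [Matrix.fromBlocks_apply₁₂]; exact isHomogeneous_zero _ _ _
    · rw [Matrix.fromBlocks_apply₂₁]; exact isHomogeneous_zero _ _ _
    · rw [Matrix.fromBlocks_apply₂₂]; exact isHomogeneous_zero _ _ _
  · have hpow : A' ^ n = Matrix.reindex e e ((Matrix.fromBlocks A 0 0
        (0 : Matrix (Fin (m - m₁)) (Fin (m - m₁)) (MvPolynomial σ k))) ^ n) := by
      rw [hA']
      change (Matrix.reindexAlgEquiv k _ e _) ^ n = Matrix.reindexAlgEquiv k _ e _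
      rw [map_pow]
    rw [hpow, trace_reindex, Matrix.fromBlocks_diagonal_pow, trace_fromBlocks', zero_pow hn.ne',
      Matrix.trace_zero, add_zero, hAtr]

/-- **GIP Prop. 5, the substitution.** If `per_n = tr(A^n)` for an `m × m` matrix `A` of
homogeneous linear forms (`n ≤ m`), then the block permanent `per_n ∈ 𝔸^n_m` (lexicographic
`m²` variables) is a linear substitution `M · Pow^n_m` of `Pow^n_m = tr(X^n)` by the coefficient
matrix `M` of the entries of `A` (possibly singular): `X_{(a,b)} ↦ A_{ab}` (as `per ↦ per ∘ M`,
"completely analogously to Prop. 2"). [cite: GesmundoIkenmeyerPanova2017, Prop. 5] -/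
theorem exists_linSubst_powFormLex_eq (hnm : n ≤ m)
    (h : HasPowTraceRepr ℂ (perPoly (Fin n) ℂ) n m) :
    ∃ M : Matrix (MatIdx m) (MatIdx m) ℂ,
      linSubst (MatIdx m) ℂ M (powFormLex ℂ m n) = Literature.Barriers.PneNP.blockPerFormLex n m := by
  classical
  obtain ⟨A, hA1, hAtr⟩ := h
  -- rename the entries into the lexicographic matrix variables
  set A'' : Matrix (Fin m) (Fin m) (MvPolynomial (MatIdx m) ℂ) := A.map (rename (blockEmb hnm))
    with hA''
  have hA''1 : ∀ a b, (A'' a b).IsHomogeneous 1 := fun a b => (hA1 a b).rename_isHomogeneous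
  have hper : Literature.Barriers.PneNP.blockPerFormLex n m = (A'' ^ n).trace := by
    rw [blockPerFormLex_eq_rename hnm, ← hAtr, algHom_trace_pow, AlgHom.mapMatrix_apply]
  -- the substitution matrix
  set M : Matrix (MatIdx m) (MatIdx m) ℂ :=
    Matrix.of fun v w => coeff (Finsupp.single v 1) (A'' (ofLex w).1 (ofLex w).2) with hM
  refine ⟨M, ?_⟩
  set ψ : MvPolynomial (Fin m × Fin m) ℂ →ₐ[ℂ] MvPolynomial (MatIdx m) ℂ :=
    (linSubst (MatIdx m) ℂ M).comp (rename toLex) with hψ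
  have hψX : ψ.mapMatrix (Matrix.mvPolynomialX (Fin m) (Fin m) ℂ) = A'' := by
    refine Matrix.ext fun a b => ?_
    rw [AlgHom.mapMatrix_apply, Matrix.map_apply, Matrix.mvPolynomialX_apply, hψ, AlgHom.comp_apply,
      rename_X, linSubst_X, eq_sum_coeff_smul_X (hA''1 a b)]
    refine Finset.sum_congr rfl fun v _ => ?_
    rw [hM, Matrix.of_apply]
    rfl
  calc linSubst (MatIdx m) ℂ M (powFormLex ℂ m n)
      = ψ (powTrace ℂ m n) := rfl
    _ = (A'' ^ n).trace := by rw [powTrace, algHom_trace_pow, hψX]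
    _ = _ := hper.symm

/-- **GIP Prop. 5, the containment**: hence `per_n ∈ \overline{GL_{m²} · Pow^n_m}` (`GL` is
Zariski dense in `End`, tree `endOrbit_subset_orbitClosure_holds`), so that
`\overline{GL_{m²} per_n} ⊆ \overline{GL_{m²} Pow^n_m}` whenever `pc(per_n) ≤ m`: "If
`\overline{GL_{n²} per_m} ⊄ \overline{GL_{n²} Pow_n^m}`, then `pc(per_m) > n`."
[cite: GesmundoIkenmeyerPanova2017, Prop. 5] -/
theorem blockPerFormLex_mem_orbitClosure_powFormLex (hnm : n ≤ m)
    (h : HasPowTraceRepr ℂ (perPoly (Fin n) ℂ) n m) :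
    Literature.Barriers.PneNP.blockPerFormLex n m ∈ orbitClosure (powFormLex ℂ m n) := by
  obtain ⟨M, hM⟩ := exists_linSubst_powFormLex_eq hnm h
  exact endOrbit_subset_orbitClosure_holds (powFormLex ℂ m n) ⟨M, hM⟩

end PropFive

/-! ### The junk regime `m < n`: only the weight `0` occurs -/

section Degenerate

/-- A highest weight of the degree-`mdeg` coordinate ring of a form of ANOTHER degree `c ≠ mdeg`
is zero: all degree-`mdeg` coefficients vanish on the orbit, so the monomial of torus weight `χ`
produced by the master lemma `exists_monWeight_eq_of_sub_mem` (all of whose coordinates are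
nonzero at a generic orbit point) is the empty monomial. [folklore] -/
theorem weight_eq_zero_of_hasHighestWeight_of_isHomogeneous {σ : Type*} [Fintype σ]
    [LinearOrder σ] {k : Type*} [Field k] [Infinite k] {f : MvPolynomial σ k} {c mdeg : ℕ}
    (hf : f.IsHomogeneous c) (hc : c ≠ mdeg) {χ : Weight σ}
    (h : HasHighestWeight (orbitCoordRep f mdeg) χ) : χ = 0 := by
  classical
  obtain ⟨F, hFI, hF⟩ := exists_lift_of_hasHighestWeight_orbitCoordRep f h
  obtain ⟨g, hg⟩ := exists_aeval_formCoeff_ne_zero_of_not_mem hFI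
  obtain ⟨s, -, hw, hne⟩ := exists_monWeight_eq_of_sub_mem hF g hg
  have hs : s = 0 := by
    by_contra hs0
    obtain ⟨d, hd⟩ := Finsupp.support_nonempty_iff.mpr hs0
    apply hne d hd
    have hhom : (linSubstRep σ k g f).IsHomogeneous c := by
      rw [linSubstRep_apply]; exact linSubst_isHomogeneous _ hf
    exact hhom.coeff_eq_zero (by rw [mem_degMonomials_iff.mp d.2]; exact Ne.symm hc)
  rw [← hw, hs]
  funext i
  rw [monWeight_apply, Finsupp.support_zero, Finset.sum_empty, Nat.cast_zero, neg_zero]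
  rfl

/-- If the weight `λ*` (`partitionWeightLex`) of a partition `λ ⊢ N` with at most `m²` parts
vanishes then `N = 0` (the weight of `λ` has size `N`). [folklore] -/
theorem eq_zero_of_partitionWeightLex_eq_zero {m N : ℕ} (lam : Nat.Partition N)
    (hlam : lam.parts.card ≤ m * m)
    (h : Literature.Computability.Complexity.partitionWeightLex m lam = 0) : N = 0 := by
  have h1 : Weight.ofPartition (m * m) lam = 0 := by
    funext i
    have := congr_fun h (matIdxEquiv m (Fin.rev i))
    change (Weight.dualOfPartition (m * m) lam) ((matIdxEquiv m).symm (matIdxEquiv m (Fin.rev i))) =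
      0 at this
    rw [OrderIso.symm_apply_apply, Weight.dualOfPartition, Weight.dual] at this
    simp only [Fin.rev_rev, neg_eq_zero] at this
    exact this
  have hsize := Weight.size_ofPartition_holds hlam
  rw [h1] at hsize
  simp only [Weight.size, Pi.zero_apply, Finset.sum_const_zero] at hsize
  exact_mod_cast hsize.symm

end Degenerate

/-! ### Assembly: the discharge of `GIP2017_cor9` -/

/-- The matrix power trace of the `PneNP` catalogue entry (`Literature.Barriers.PneNP.powTraceFormLex`,
matrix size `m`, exponent `n`) is this development's `powFormLex ℂ m n` (definitional).
[cite: GesmundoIkenmeyerPanova2017, §2.2 (definition of Pow)] -/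
theorem powTraceFormLex_eq_powFormLex (m n : ℕ) :
    Literature.Barriers.PneNP.powTraceFormLex m n = powFormLex ℂ m n :=
  rfl

/-- **GIP Thm. 8, "`t_{λ,n}(d[m]) ≤ sm(λ, n)`", in the barrier file's vocabulary (proved).** If
`λ ⊢ D` with at most `m²` parts occurs (weight `partitionWeightLex m λ`) in the degree-`n`
coordinate ring of `\overline{GL_{m²} · Pow^n_m}`, then `SmPos m λ`, i.e.
`sm(λ, m) = Σ_{μ ⊢ D, ℓ(μ) ≤ m} sk(λ, μ) > 0`. In particular an ORBIT-CLOSURE occurrence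
obstruction in the matrix-powering model is a fortiori an orbit occurrence obstruction.
[cite: GesmundoIkenmeyerPanova2017, Thm. 8 with Thm. 24] -/
theorem smPos_of_hasHighestWeight_powTraceFormLex {n m D : ℕ}
    (lam : Nat.Partition D) (hcard : lam.parts.card ≤ m * m)
    (h : HasHighestWeight (orbitCoordRep (Literature.Barriers.PneNP.powTraceFormLex m n) n)
      (Literature.Computability.Complexity.partitionWeightLex m lam)) :
    SmPos m lam := by
  obtain ⟨μ, hμ, hsum⟩ :=
    exists_sum_ne_zero_of_hasHighestWeight_powFormLex (k := ℂ) (m := m) lam hcard h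
  exact ⟨μ, hμ, hsum⟩

/-- The unpadded block permanent is homogeneous of degree `|TopBlockIdx n m|` (`= n` for
`n ≤ m`, `= m` for `m < n`). [folklore] -/
theorem blockPerFormLex_isHomogeneous_card (n m : ℕ) :
    (Literature.Barriers.PneNP.blockPerFormLex n m).IsHomogeneous
      (Fintype.card (Literature.Computability.Complexity.TopBlockIdx n m)) := by
  unfold Literature.Barriers.PneNP.blockPerFormLex Literature.Barriers.PneNP.blockPerPoly
  exact ((perPoly_isHomogeneous (n := Literature.Computability.Complexity.TopBlockIdx n m)
    (k := ℂ)).rename_isHomogeneous).rename_isHomogeneous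

/-- **Discharge of `GIP2017_cor9` (Gesmundo–Ikenmeyer–Panova 2017, Cor. 9).** "If `λ ⊢ dm` and
`sm(λ, n) = 0 < q_λ(d[m])`, then `pc(per_m) > n`" — in the tree's letters and rendering: for
`3 ≤ n`, `3 ≤ m`, an orbit occurrence obstruction `λ ⊢ d·n` (`IsOrbitOccurrenceObstruction n m λ`:
at most `m²` parts, `λ*` occurs in `ℂ[\overline{GL_{m²} per_n}]_d`, `¬ SmPos m λ`) forces
`m < powTraceComplexity ℂ per_n n`. Proof as printed: were `pc(per_n) ≤ m`, then
`per_n = tr(A^n)` with `A` an `m × m` matrix of linear forms (`exists_hasPowTraceRepr_perPoly`,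
`Nat.sInf_mem`, `HasPowTraceRepr.of_le`), so `per_n ∈ \overline{GL · Pow^n_m}` (Prop. 5,
`blockPerFormLex_mem_orbitClosure_powFormLex`), `λ*` occurs in `ℂ[\overline{GL · Pow^n_m}]`
(Cor. 6 / Schur, `hasHighestWeight_orbitCoordRep_of_mem_orbitClosure`), and the Thm. 8
inequality `t_λ ≤ sm(λ)` (`exists_sum_ne_zero_of_hasHighestWeight_powFormLex`) gives
`sm(λ, m) > 0`, a contradiction. In the junk regime `m < n` of the rendering the occurrence
hypothesis forces `d = 0` (`weight_eq_zero_of_hasHighestWeight_of_isHomogeneous`,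
`eq_zero_of_partitionWeightLex_eq_zero`), where `sm > 0` (`smPos_of_eq_zero`,
`GCTMatrixPoweringProofs.lean`). [cite: GesmundoIkenmeyerPanova2017, Cor. 9 (with Prop. 5, Cor. 6, Thm. 8)] -/
theorem GIP2017_cor9_holds : GIP2017_cor9 := by
  intro n m d hn hm lam hobs
  obtain ⟨hcard, hocc, hsm⟩ := hobs
  rcases le_or_gt n m with hnm | hmn
  · -- the printed argument
    haveI : NeZero n := ⟨by omega⟩
    obtain ⟨N₀, hN₀⟩ := exists_hasPowTraceRepr_perPoly n
    by_contra hlt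
    rw [not_lt] at hlt
    have hmem : HasPowTraceRepr ℂ (perPoly (Fin n) ℂ) n (powTraceComplexity ℂ (perPoly (Fin n) ℂ) n) :=
      Nat.sInf_mem (s := {m' | HasPowTraceRepr ℂ (perPoly (Fin n) ℂ) n m'}) ⟨N₀, hN₀⟩
    have hm' : HasPowTraceRepr ℂ (perPoly (Fin n) ℂ) n m :=
      HasPowTraceRepr.of_le (by omega) hlt hmem
    have hcl := blockPerFormLex_mem_orbitClosure_powFormLex hnm hm'
    have hocc' :=
      Literature.Computability.Complexity.hasHighestWeight_orbitCoordRep_of_mem_orbitClosure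
        (m := n) hcl hocc
    exact hsm (smPos_of_hasHighestWeight_powTraceFormLex lam hcard hocc')
  · -- junk regime `m < n`: only the weight `0` occurs, so `d = 0`
    exfalso
    apply hsm
    have hc : Fintype.card (Literature.Computability.Complexity.TopBlockIdx n m) ≠ n := by
      have h1 : Fintype.card (Literature.Computability.Complexity.TopBlockIdx n m) ≤
          Fintype.card (Fin m) := Fintype.card_subtype_le _
      rw [Fintype.card_fin] at h1
      omega
    have hχ := weight_eq_zero_of_hasHighestWeight_of_isHomogeneous
      (blockPerFormLex_isHomogeneous_card n m) hc hocc
    exact smPos_of_eq_zero (eq_zero_of_partitionWeightLex_eq_zero lam hcard hχ) m lam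

end Literature.Barriers.ValiantsHypothesis
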